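import Summits.QuantumFields.YangMills.Theorems.ReplicaVarianceTiltHeightChiSqLAcIntegrable
import Summits.QuantumFields.YangMills.Theorems.FluctuationComparisonRegPrIntLSupTailFloorOfWreg
import HarnessLib

/-!
# `FluctuationComparisonRegPrIntLQuantDescendDominated` — THE DESCENDED GIBBS LAW IS DOMINATED BY PRODUCT HAAR MEASURE; hence the
# SMALL-`J` FLOOR of the TAILSUP₁∘ door suite is UNCONDITIONAL at every `(J, K)` (crux `UnitScaleTilt.FluctuationComparisonRegPrIntL`,
# stmt-QuantumFields-20520; helper `--supports`, count-neutral)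

Cell `ym3-torus` (YM ladder rung R3 = continuum SU(2) Yang–Mills on T³ — a RUNG, NOT the Clay problem: not d = 4, not
infinite volume, not a mass gap); seat `ym-line-cst-p1` (gen 35).  THEOREMS ONLY (0 `def`, 0 `sorry`, default heartbeats).
THE DOCK of the `L^∞` letter «`(avgFun ℰp)_* dU ≤ C • dV`» — IN THE TREE as ✓`HeightChiSqL.guardedFibreLaw_le_smul_of` (the
guarded exp-mean-log fibre laws, one constant for all environments) + ✓`HeightChiSqLOfFibreLawBound.map_fieldMeasure_avgFun_le_of_guard`
(the bounded triangular push-forward), located by seat ym3-torus-px20 g11 2026-08-30T06:01Z in the ReplicaVarianceTilt ∕ HeightChiSqL lineage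
(stmt-QuantumFields-26133 helpers) — on the hypothesis `hdom` of ✓`…SupTailFloorOfWreg.floor_of_wreg` (seat px21 g13, p762763).  (This seat's
independent certificate of the same letter — ✓`…QuantLemmaAEuclid` p763264 + HOME `pub/ideators/ym-r3-idea-2/cst-p1-g35/` files
`QuantLemmaA(Matrix.specialUnitaryGroup (Fin 2) ℂ){,Param}`, `QuantFibreLawEML`, `QuantAvgFunBound` — is not re-filed, by the dedup norm.)

CONTENTS.
* §1 `exists_fieldMeasure_map_avgFun_le` (one (0.4) step, from the two tree letters), `exists_fieldMeasure_map_iter_le` — iterating: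
  `(dU_K)_* (Ū^k) ≤ C_k • dU_K^{(k)}` (induction on `k`).
* §2 `exists_fieldMeasure_map_descendTo_le` — the descent `D_{n,K} = fieldShift ∘ Ū^{K−n}`: `(dU_K).map D_{n,K} ≤ C • dU_n`
  (lit `measurePreserving_fieldShift`).
* §3 ★★ `exists_gibbsK_descendTo_le` — `∃ C > 0, ∀ B measurable, Gibbs_K(D_{n,K}⁻¹ B) ≤ ofReal C · dU_n(B)` (`e^{−βA} ≤ 1`): the
  hypothesis `hdom` of `floor_of_wreg`, for EVERY window (indeed every measurable `B`), every `n ≤ K`, `γ ≥ 0`.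
* §4 ★★★ `floor_allDepths` — THE SMALL-`J` FLOOR, UNCONDITIONAL AT EVERY `J ≤ K`: `∀ L b₀ p₀, 0 < b₀ → 0 < p₀ → ∃ γ₁ > 0, ∀ F γ, F.L = L →
  0 < γ → γ ≤ γ₁ → ∀ J K (hJK : J ≤ K) c, 0 < c → c < 1 → ∃ q > 0, ∀ B ⊆ W_J(c·b₀) measurable,
  ofReal q · Gibbs_K(D_{J,K}⁻¹B) ≤ Gibbs_K(D_{J,K}⁻¹B ∩ histGood(θBal b₀) K J)` = ✓`floor_of_wreg` ∘ §3 (g22-2's PERS₁∘-class positivity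
  with `q` depending on `K`).  The DEPTH-ONE case `K = J + 1` (the FLOOR conjunct of ✓`…SupTailCoverUnionTwoRegime` v1.2 ∕ ✓`…FibreTail` v1.1 ∕
  ✓`…PrintedLeaf`) is seat ym3-torus-px20 g11's `…SupTailFloorDepthOne` (typed first, 2026-08-30T06:06Z); this file is its all-`(J, K)`
  generalisation and does not restate it.

HYP-SAT (★★OWNER RULING №42): every hypothesis is a range condition on the literal families (`F.L = L`, `0 < γ ≤ γ₁(L, b₀, p₀)`,
`0 < c < 1`, `0 < b₀`, `0 < p₀`); `q` is bound after `F, γ, J, K, c` — satisfiable at the true quantifier order by construction; the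
floor is SUPPLY for the FLOOR conjunct only (the TAIL ∕ MOMENT ∕ eventual-smallness conjuncts of O ∕ P are other hands').
HONEST: WREG + compactness (px21) + the EML image-law bound (HeightChiSqL lineage) + bookkeeping (here); no row, stub, crux or summit statement is proved; TAILSUP₁∘ ∕ PERS₁∘ ∕ POS∘ ∕
stmt-QuantumFields-20520 NOT proved; rung R3 = SU(2) YM₃ on T³ — NOT d = 4, NOT infinite volume, NOT a mass gap, NOT Clay.
-/

set_option autoImplicit false

noncomputable section

open MeasureTheory Set Function
open scoped ENNReal NNReal

namespace Summit.QuantumFields.YangMills.Theorems.FluctuationComparisonRegPrIntLQuantDescendDominated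

open Literature.MathematicalPhysics.QuantumFieldTheory.Balaban1983to89
open Literature.MathematicalPhysics.QuantumFieldTheory.Balaban1983to89.T3ContinuumYM3Torus
open Literature.MathematicalPhysics.QuantumFieldTheory.Balaban1983to89.T3UnitLawDensityEML
open Literature.MathematicalPhysics.QuantumFieldTheory.Balaban1983to89.T3UnitScaleTilt
open Literature.MathematicalPhysics.QuantumFieldTheory.Balaban1983to89.T3TiltDescent
open Literature.MathematicalPhysics.QuantumFieldTheory.Balaban1983to89.T3LevelShift
open Literature.MathematicalPhysics.QuantumFieldTheory.Balaban1983to89.Missing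
open Literature.MathematicalPhysics.QuantumFieldTheory.Balaban1983to89.ExpMeanLog (expMeanLogSU measurable_expMeanLogSU_E)
open Literature.MathematicalPhysics.QuantumFieldTheory.Balaban1983to89.BlockAveraging (blockAvg avgFun measurable_avgFun)
open Summit.QuantumFields.YangMills.Theorems.HeightChiSqL (guardedFibreLaw_le_smul_of)
open Summit.QuantumFields.YangMills.Theorems.HeightChiSqLOfFibreLawBound (map_fieldMeasure_avgFun_le_of_guard)
open Summit.QuantumFields.YangMills.Theorems.FluctuationComparisonRegPrIntLSupTailFloorOfWreg (floor_of_wreg)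

/-! ## §1 Iterated averagings -/

section Iter

variable {P : Params}

/-- The `k`-fold (0.4)-averaging from the finest lattice is measurable. [folklore] -/
theorem measurable_iter_blockAvg (k : ℕ) :
    Measurable (Averaging.iter (fun i => blockAvg (P := P) (j := i) (expMeanLogSU (n := Fin 2))) k :
      GaugeField P 0 (Matrix.specialUnitaryGroup (Fin 2) ℂ) → GaugeField P k (Matrix.specialUnitaryGroup (Fin 2) ℂ)) :=
  T4Continuum.measurable_iter _ (fun _ => measurable_avgFun (expMeanLogSU (n := Fin 2)) measurable_expMeanLogSU_E) k

/-- ★ **ONE (0.4) STEP: `(dU^{(j)}).map Ū ≤ C • dU^{(j+1)}`** with a finite constant — the two tree letters composed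
(✓`HeightChiSqL.guardedFibreLaw_le_smul_of` ∘ ✓`HeightChiSqLOfFibreLawBound.map_fieldMeasure_avgFun_le_of_guard`). [cite: Balaban1987RG1, (0.4) p.253] -/
theorem exists_fieldMeasure_map_avgFun_le {j : ℕ} (hj : j + 1 ≤ P.m + P.K) :
    ∃ C : ℝ≥0∞, C ≠ ⊤ ∧ (fieldMeasure P j (Matrix.specialUnitaryGroup (Fin 2) ℂ)).map (avgFun ℰp : GaugeField P j (Matrix.specialUnitaryGroup (Fin 2) ℂ) → GaugeField P (j+1) (Matrix.specialUnitaryGroup (Fin 2) ℂ)) ≤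
      C • fieldMeasure P (j+1) (Matrix.specialUnitaryGroup (Fin 2) ℂ) := by
  obtain ⟨C, hCtop, hle⟩ := guardedFibreLaw_le_smul_of P j
  refine ⟨(C + 1) ^ Fintype.card (PBond P (j+1)), ENNReal.pow_ne_top (ENNReal.add_ne_top.mpr ⟨hCtop, ENNReal.one_ne_top⟩), ?_⟩
  exact map_fieldMeasure_avgFun_le_of_guard hj ℰp measurableE_ℰp hle

/-- ★ **ITERATED IMAGE-LAW BOUND**: for `k ≤ m + K` the push-forward of product Haar measure under the `k`-fold (0.4)-averaging with
the printed average is dominated by product Haar measure on `T^{(k)}` (induction, one step at a time). [cite: Balaban1987RG1, (0.4)/(0.11) p.253] -/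
theorem exists_fieldMeasure_map_iter_le :
    ∀ k : ℕ, k ≤ P.m + P.K → ∃ C : ℝ≥0∞, C ≠ ⊤ ∧
      (fieldMeasure P 0 (Matrix.specialUnitaryGroup (Fin 2) ℂ)).map (Averaging.iter (fun i => blockAvg (P := P) (j := i) (expMeanLogSU (n := Fin 2))) k) ≤
        C • fieldMeasure P k (Matrix.specialUnitaryGroup (Fin 2) ℂ)
  | 0, _ => by
      refine ⟨1, ENNReal.one_ne_top, ?_⟩
      have : (Averaging.iter (fun i => blockAvg (P := P) (j := i) (expMeanLogSU (n := Fin 2))) 0 :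
          GaugeField P 0 (Matrix.specialUnitaryGroup (Fin 2) ℂ) → GaugeField P 0 (Matrix.specialUnitaryGroup (Fin 2) ℂ)) = id := funext fun U => rfl
      rw [this, Measure.map_id, one_smul]
  | k + 1, hk => by
      obtain ⟨C₁, hC₁top, hC₁⟩ := exists_fieldMeasure_map_iter_le k (Nat.le_of_succ_le hk)
      obtain ⟨C₂, hC₂top, hC₂⟩ := exists_fieldMeasure_map_avgFun_le (P := P) (j := k) hk
      refine ⟨C₁ * C₂, ENNReal.mul_ne_top hC₁top hC₂top, ?_⟩
      have hcomp : (Averaging.iter (fun i => blockAvg (P := P) (j := i) (expMeanLogSU (n := Fin 2))) (k + 1) :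
            GaugeField P 0 (Matrix.specialUnitaryGroup (Fin 2) ℂ) → GaugeField P (k + 1) (Matrix.specialUnitaryGroup (Fin 2) ℂ)) =
          (avgFun (expMeanLogSU (n := Fin 2)) : GaugeField P k (Matrix.specialUnitaryGroup (Fin 2) ℂ) → GaugeField P (k+1) (Matrix.specialUnitaryGroup (Fin 2) ℂ)) ∘
            Averaging.iter (fun i => blockAvg (P := P) (j := i) (expMeanLogSU (n := Fin 2))) k :=
        funext fun U => rfl
      have hmA : Measurable (avgFun (expMeanLogSU (n := Fin 2)) : GaugeField P k (Matrix.specialUnitaryGroup (Fin 2) ℂ) → GaugeField P (k+1) (Matrix.specialUnitaryGroup (Fin 2) ℂ)) :=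
        measurable_avgFun _ measurable_expMeanLogSU_E
      rw [hcomp, ← Measure.map_map hmA (measurable_iter_blockAvg k)]
      calc ((fieldMeasure P 0 (Matrix.specialUnitaryGroup (Fin 2) ℂ)).map _).map (avgFun (expMeanLogSU (n := Fin 2)))
          ≤ (C₁ • fieldMeasure P k (Matrix.specialUnitaryGroup (Fin 2) ℂ)).map (avgFun (expMeanLogSU (n := Fin 2))) := Measure.map_mono hC₁ hmA
        _ = C₁ • (fieldMeasure P k (Matrix.specialUnitaryGroup (Fin 2) ℂ)).map (avgFun (expMeanLogSU (n := Fin 2))) := Measure.map_smul _ _ _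
        _ ≤ C₁ • (C₂ • fieldMeasure P (k + 1) (Matrix.specialUnitaryGroup (Fin 2) ℂ)) := by
            refine Measure.le_iff.mpr fun T hT => ?_
            have := Measure.le_iff.mp hC₂ T hT
            simp only [Measure.smul_apply, smul_eq_mul] at this ⊢
            gcongr
        _ = (C₁ * C₂) • fieldMeasure P (k + 1) (Matrix.specialUnitaryGroup (Fin 2) ℂ) := by rw [smul_smul]

end Iter

/-! ## §2 The descent `D_{n,K}` -/

section Descend

variable (F : T3Family)

/-- ★ **THE DESCENDED PRODUCT LAW IS DOMINATED**: `(dU_K).map D_{n,K} ≤ C • dU_n` (`D_{n,K} = fieldShift ∘ Ū^{K−n}`; §1 and lit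
`measurePreserving_fieldShift`). [cite: Balaban1987RG1, (0.11) p.253] -/
theorem exists_fieldMeasure_map_descendTo_le {n K : ℕ} (h : n ≤ K) :
    ∃ C : ℝ≥0∞, C ≠ ⊤ ∧ (fieldMeasure (F.P K) 0 (Matrix.specialUnitaryGroup (Fin 2) ℂ)).map (descendTo F ℰp n K h) ≤ C • fieldMeasure (F.P n) 0 (Matrix.specialUnitaryGroup (Fin 2) ℂ) := by
  have hk : K - n ≤ (F.P K).m + (F.P K).K := by show K - n ≤ F.m + K; omega
  obtain ⟨C, hCtop, hC⟩ := exists_fieldMeasure_map_iter_le (P := F.P K) (K - n) hk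
  refine ⟨C, hCtop, ?_⟩
  have hfs := measurePreserving_fieldShift (G := (Matrix.specialUnitaryGroup (Fin 2) ℂ))
    (F.sitesPerDir_eq (m := F.m) (K := n) (j := 0) (m' := F.m) (K' := K) (j' := K - n) (by omega))
  have hit : Measurable (Averaging.iter (fun i => blockAvg (P := F.PP F.m K) (j := i) (expMeanLogSU (n := Fin 2))) (K - n) :
      GaugeField (F.PP F.m K) 0 (Matrix.specialUnitaryGroup (Fin 2) ℂ) → GaugeField (F.PP F.m K) (K - n) (Matrix.specialUnitaryGroup (Fin 2) ℂ)) := measurable_iter_blockAvg (K - n)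
  have hC' : (fieldMeasure (F.PP F.m K) 0 (Matrix.specialUnitaryGroup (Fin 2) ℂ)).map
      (Averaging.iter (fun i => blockAvg (P := F.PP F.m K) (j := i) (expMeanLogSU (n := Fin 2))) (K - n)) ≤
        C • fieldMeasure (F.PP F.m K) (K - n) (Matrix.specialUnitaryGroup (Fin 2) ℂ) := hC
  have key : (fieldMeasure (F.P K) 0 (Matrix.specialUnitaryGroup (Fin 2) ℂ)).map (descendTo F ℰp n K h) =
      ((fieldMeasure (F.PP F.m K) 0 (Matrix.specialUnitaryGroup (Fin 2) ℂ)).map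
        (Averaging.iter (fun i => blockAvg (P := F.PP F.m K) (j := i) (expMeanLogSU (n := Fin 2))) (K - n))).map
          (fieldShift (F.sitesPerDir_eq (m := F.m) (K := n) (j := 0) (m' := F.m) (K' := K) (j' := K - n) (by omega))) :=
    (Measure.map_map hfs.measurable hit).symm
  rw [key]
  have h1 := Measure.map_mono hC' hfs.measurable
  have h2 : (C • fieldMeasure (F.PP F.m K) (K - n) (Matrix.specialUnitaryGroup (Fin 2) ℂ)).map
      (fieldShift (F.sitesPerDir_eq (m := F.m) (K := n) (j := 0) (m' := F.m) (K' := K) (j' := K - n) (by omega))) =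
        C • fieldMeasure (F.PP F.m n) 0 (Matrix.specialUnitaryGroup (Fin 2) ℂ) := by
    rw [Measure.map_smul, hfs.map_eq]
  exact h1.trans (le_of_eq h2)

/-! ## §3 The descended GIBBS law is dominated (`e^{−βA} ≤ 1`) -/

/-- ★★ **`hdom` UNCONDITIONALLY**: for `γ ≥ 0` and `n ≤ K` there is `C > 0` with `Gibbs_K(D_{n,K}⁻¹ B) ≤ ofReal C · dU_n(B)` for EVERY
measurable `B` (Boltzmann weight `≤ 1`, partition function `> 0`, §2) — the hypothesis `hdom` of
✓`…SupTailFloorOfWreg.floor_of_wreg`, discharged. [cite: Balaban1985UV3, (2) p.256] -/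
theorem exists_gibbsK_descendTo_le {γ : ℝ} (hγ : 0 ≤ γ) {n K : ℕ} (h : n ≤ K) :
    ∃ C : ℝ, 0 < C ∧ ∀ B : Set (GaugeField (F.P n) 0 (Matrix.specialUnitaryGroup (Fin 2) ℂ)), MeasurableSet B →
      gibbsK F ℰp γ K (descendTo F ℰp n K h ⁻¹' B) ≤ ENNReal.ofReal C * fieldMeasure (F.P n) 0 (Matrix.specialUnitaryGroup (Fin 2) ℂ) B := by
  obtain ⟨C, hCtop, hC⟩ := exists_fieldMeasure_map_descendTo_le F h
  set β : ℝ := (F.scheme ℰp γ).β K with hβdef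
  have hβ : 0 ≤ β := F.scheme_β_nonneg ℰp hγ K
  have hZ : 0 < partitionFn (G := (Matrix.specialUnitaryGroup (Fin 2) ℂ)) (F.P K) β := partitionFn_pos' (F.P K) hβ
  refine ⟨(partitionFn (G := (Matrix.specialUnitaryGroup (Fin 2) ℂ)) (F.P K) β)⁻¹ * (C.toReal + 1), by positivity, fun B hB => ?_⟩
  have hD : Measurable (descendTo F ℰp n K h : GaugeField (F.P K) 0 (Matrix.specialUnitaryGroup (Fin 2) ℂ) → GaugeField (F.P n) 0 (Matrix.specialUnitaryGroup (Fin 2) ℂ)) :=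
    measurable_descendTo F ℰp measurableE_ℰp h
  have hpre : MeasurableSet (descendTo F ℰp n K h ⁻¹' B) := hD hB
  -- the Gibbs measure against product Haar: `Z⁻¹ · ∫⁻_{D⁻¹B} e^{−βA} ≤ Z⁻¹ · dU(D⁻¹B)`
  rw [gibbsK_eq, T4GenFunBounds.gibbsMeasure, Measure.smul_apply, withDensity_apply _ hpre, smul_eq_mul]
  have h1 : ∫⁻ U in descendTo F ℰp n K h ⁻¹' B, ENNReal.ofReal (boltzmann (F.P K) β U) ∂fieldMeasure (F.P K) 0 (Matrix.specialUnitaryGroup (Fin 2) ℂ) ≤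
      fieldMeasure (F.P K) 0 (Matrix.specialUnitaryGroup (Fin 2) ℂ) (descendTo F ℰp n K h ⁻¹' B) := by
    calc ∫⁻ U in descendTo F ℰp n K h ⁻¹' B, ENNReal.ofReal (boltzmann (F.P K) β U) ∂fieldMeasure (F.P K) 0 (Matrix.specialUnitaryGroup (Fin 2) ℂ)
        ≤ ∫⁻ _ in descendTo F ℰp n K h ⁻¹' B, 1 ∂fieldMeasure (F.P K) 0 (Matrix.specialUnitaryGroup (Fin 2) ℂ) :=
          lintegral_mono fun U => ENNReal.ofReal_le_one.mpr (boltzmann_le_one (F.P K) hβ U)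
      _ = fieldMeasure (F.P K) 0 (Matrix.specialUnitaryGroup (Fin 2) ℂ) (descendTo F ℰp n K h ⁻¹' B) := by rw [setLIntegral_one]
  have h2 : fieldMeasure (F.P K) 0 (Matrix.specialUnitaryGroup (Fin 2) ℂ) (descendTo F ℰp n K h ⁻¹' B) ≤ C * fieldMeasure (F.P n) 0 (Matrix.specialUnitaryGroup (Fin 2) ℂ) B := by
    have := Measure.le_iff.mp hC B hB
    rwa [Measure.map_apply hD hB, Measure.smul_apply, smul_eq_mul] at this
  have h3 : (ENNReal.ofReal (partitionFn (G := (Matrix.specialUnitaryGroup (Fin 2) ℂ)) (F.P K) β))⁻¹ =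
      ENNReal.ofReal (partitionFn (G := (Matrix.specialUnitaryGroup (Fin 2) ℂ)) (F.P K) β)⁻¹ := (ENNReal.ofReal_inv_of_pos hZ).symm
  rw [h3]
  calc ENNReal.ofReal (partitionFn (G := (Matrix.specialUnitaryGroup (Fin 2) ℂ)) (F.P K) β)⁻¹ *
        ∫⁻ U in descendTo F ℰp n K h ⁻¹' B, ENNReal.ofReal (boltzmann (F.P K) β U) ∂fieldMeasure (F.P K) 0 (Matrix.specialUnitaryGroup (Fin 2) ℂ)
      ≤ ENNReal.ofReal (partitionFn (G := (Matrix.specialUnitaryGroup (Fin 2) ℂ)) (F.P K) β)⁻¹ * (C * fieldMeasure (F.P n) 0 (Matrix.specialUnitaryGroup (Fin 2) ℂ) B) := by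
        gcongr
        exact h1.trans h2
    _ ≤ ENNReal.ofReal (partitionFn (G := (Matrix.specialUnitaryGroup (Fin 2) ℂ)) (F.P K) β)⁻¹ * (ENNReal.ofReal (C.toReal + 1) * fieldMeasure (F.P n) 0 (Matrix.specialUnitaryGroup (Fin 2) ℂ) B) := by
        gcongr
        calc C = ENNReal.ofReal C.toReal := (ENNReal.ofReal_toReal hCtop).symm
          _ ≤ ENNReal.ofReal (C.toReal + 1) := ENNReal.ofReal_le_ofReal (by linarith)
    _ = ENNReal.ofReal ((partitionFn (G := (Matrix.specialUnitaryGroup (Fin 2) ℂ)) (F.P K) β)⁻¹ * (C.toReal + 1)) * fieldMeasure (F.P n) 0 (Matrix.specialUnitaryGroup (Fin 2) ℂ) B := by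
        rw [ENNReal.ofReal_mul (inv_nonneg.mpr hZ.le), mul_assoc]

end Descend

/-! ## §4 The small-`J` floor, unconditional -/

section Floor

/-- ★★★ **THE SMALL-`J` FLOOR OF THE TAILSUP₁∘ DOOR SUITE, UNCONDITIONAL AT EVERY `(J, K)`.**  For every `L, b₀ > 0, p₀ > 0` there is
`γ₁ > 0` such that for every family `F` (`F.L = L`), `0 < γ ≤ γ₁`, every `J ≤ K` and window fraction `0 < c < 1` there is `q > 0`
with, for every measurable `B` in the interior window `W_J(c·b₀)`:
`ofReal q · Gibbs_K(D_{J,K}⁻¹B) ≤ Gibbs_K(D_{J,K}⁻¹B ∩ histGood(θBal b₀) K J)`.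
(✓`floor_of_wreg` — WREG's continuity + positivity of the hist-restricted canonical density on the closed interior window,
seat px21 g13 — with its one hypothesis `hdom` discharged by §3: the EML image-law density bound.)  `q` depends on `F, γ, J, K, c`;
no `K`-uniformity is claimed (that would be UV stability). [cite: Balaban1985UV3, (38)-(40) p.266; Balaban1987RG1, (0.4) p.253] -/
theorem floor_allDepths :
    ∀ (L : ℕ) (b₀ p₀ : ℝ), 0 < b₀ → 0 < p₀ → ∃ γ₁ : ℝ, 0 < γ₁ ∧ ∀ (F : T3Family) (γ : ℝ), F.L = L → 0 < γ → γ ≤ γ₁ →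
      ∀ (J K : ℕ) (hJK : J ≤ K) (c : ℝ), 0 < c → c < 1 →
        ∃ q : ℝ, 0 < q ∧ ∀ B : Set (GaugeField (F.P J) 0 (Matrix.specialUnitaryGroup (Fin 2) ℂ)), MeasurableSet B →
          B ⊆ {U | PlaqSmall (θBal F.L γ (c * b₀) p₀ J) U} →
          ENNReal.ofReal q * gibbsK F ℰp γ K (descendTo F ℰp J K hJK ⁻¹' B) ≤
            gibbsK F ℰp γ K (descendTo F ℰp J K hJK ⁻¹' B ∩ histGood F ℰp (θBal F.L γ b₀ p₀) K J) := by
  intro L b₀ p₀ hb₀ hp₀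
  obtain ⟨γ₁, hγ₁, hW⟩ := floor_of_wreg L b₀ p₀ hb₀ hp₀
  refine ⟨γ₁, hγ₁, fun F γ hFL hγ hγ₁le J K hJK c hc0 hc1 => ?_⟩
  obtain ⟨C, hC, hdom⟩ := exists_gibbsK_descendTo_le F hγ.le hJK
  exact hW F γ hFL hγ hγ₁le J K hJK c hc0 hc1 C hC fun B hB _ => hdom B hB

end Floor

end Summit.QuantumFields.YangMills.Theorems.FluctuationComparisonRegPrIntLQuantDescendDominated

end
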